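import Summits.QuantumFields.YangMills.Theorems.IR.SiteRPZdBoxes

/-!
# Site-hyperplane reflection positivity, file 4∕4: `d` successive reflections double a free cube — `Z([0,m)^d)^(2^d) ≤ Z([0,2m−1)^d)`

Landed for item `stmt-QuantumFields-19354` (`--supports … --as helper`) by the LEAD prover ab-p1 under director-ym RULING g9-№2 ∕ №14 (3)
(critic ym-ir-crit-2 03:04:13Z ∕ 03:14:37Z: PASS as supplier); authored by ideator ym-ir-idea-5 g7, split of the sorry-free workfile
`Cruxes/IR/Lines/pressure_monotone_tm.lean` v5 (Part B = `Cruxes/IR/Lines/rp_doubling.lean`) per `Cruxes/IR/Lines/pressure_monotone_tm_LANDING.md`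
(eight files: `SiteRPGeometry` → `SiteRPDoubling` → `SiteRPZdBoxes` → `SiteRPFreeCubeDoubling`; `PressureMonotoneTMFloor` → `…LinearFloor` → `…LogFloor` → `…Equipartition`).

Content (§5b of Part B): `loK` and its lemmas, `zdZ_boxPlaqs_pow_le`, ★ `zdZ_cubePlaqs_pow_le`, `zdPartitionFunction_halfOpenBox_pow_sixteen_le` (`d = 4`:
`Z(B_m)^16 ≤ Z(B_{2m−1})`, Glimm–Jaffe Prop. 10.5.1 for the free Wilson cubes of any compact `G`, `β ≥ 0`).

HONESTY.  Supplier ∕ kinematic content only (holds for `U(1)` too): nothing here proves the Yang–Mills mass gap (Clay), `BalabanLadder.IR`,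
`BalabanLadder.NT` or a lattice gap; R4 closes only the conditional finite-𝕋⁴ rung `BalabanLadder.UV`.
-/

open MeasureTheory Finset Filter
open scoped ComplexConjugate

namespace Summit.QuantumFields.YangMills.Cruxes.IR.RPDoubling

open Literature.MathematicalPhysics.QuantumFieldTheory
open Literature.MathematicalPhysics.QuantumLattice

noncomputable section

/-! ## §5 (continued) Boxes: `d` successive reflections double a cube, `Z(B_m)^(2^d) ≤ Z(B_{2m-1})` -/

section Boxes

open scoped Classical
open Literature.Probability.LatticeModels (halfOpenBox Torus.proj)

variable {d : ℕ}

/-- Lower corners after reflecting in the first `k` coordinate directions (coordinates `l < k` become `2·lo l − hi l`). -/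
def loK (lo hi : Fin d → ℤ) (k : ℕ) : Fin d → ℤ := fun l => if (l : ℕ) < k then 2 * lo l - hi l else lo l

/-- `loK lo hi 0 = lo` (no reflection yet). -/
theorem loK_zero (lo hi : Fin d → ℤ) : loK lo hi 0 = lo := by
  funext l; simp [loK]

/-- At the coordinate `i = k` the corner `loK lo hi k` still equals `lo i`. -/
theorem loK_apply_of_eq (lo hi : Fin d → ℤ) {k : ℕ} {i : Fin d} (h : (i : ℕ) = k) : loK lo hi k i = lo i := by
  simp [loK, h]

/-- One more reflection: updating coordinate `i = k` of `loK lo hi k` to `2·lo i − hi i` gives `loK lo hi (k+1)`. -/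
theorem loK_succ (lo hi : Fin d → ℤ) {k : ℕ} {i : Fin d} (h : (i : ℕ) = k) :
    Function.update (loK lo hi k) i (2 * lo i - hi i) = loK lo hi (k + 1) := by
  funext l
  by_cases hl : l = i
  · subst hl; rw [Function.update_self]; simp [loK, h]
  · rw [Function.update_of_ne hl]
    have hl' : (l : ℕ) ≠ k := fun h' => hl (Fin.ext (h'.trans h.symm))
    simp only [loK]
    by_cases h1 : (l : ℕ) < k
    · rw [if_pos h1, if_pos (by omega)]
    · rw [if_neg h1, if_neg (by omega)]

/-- After `k ≥ d` reflections every coordinate is reflected: `loK lo hi k = 2·lo − hi`. -/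
theorem loK_of_le (lo hi : Fin d → ℤ) {k : ℕ} (hk : d ≤ k) : loK lo hi k = fun l => 2 * lo l - hi l := by
  funext l; simp [loK, show (l : ℕ) < k from by omega]

/-- `0 ≤ loK lo hi k l` when `lo ≤ hi` and `0 ≤ 2·lo − hi` coordinatewise. -/
theorem loK_nonneg (lo hi : Fin d → ℤ) (hlohi : ∀ l, lo l ≤ hi l) (hpos : ∀ l, 0 ≤ 2 * lo l - hi l) (k : ℕ)
    (l : Fin d) : 0 ≤ loK lo hi k l := by
  have := hlohi l; have := hpos l
  simp only [loK]; split_ifs <;> omega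

variable {N : ℕ} {G : Type*} [Group G] [TopologicalSpace G] [IsTopologicalGroup G] [CompactSpace G]
  [MeasurableSpace G] [BorelSpace G] [SecondCountableTopology G]
variable (ρ : G →* Matrix (Fin N) (Fin N) ℂ) (β : ℝ)

/-- `k` successive reflections: `Z(box)^(2^k) ≤ Z(box reflected in directions 0, …, k-1)`. -/
theorem zdZ_boxPlaqs_pow_le (hρ : Continuous ρ) (hρN : ∀ g, (ρ g).trace.re ≤ N) (hβ : 0 ≤ β)
    (lo hi : Fin d → ℤ) (hlohi : ∀ l, lo l ≤ hi l) (hpos : ∀ l, 0 ≤ 2 * lo l - hi l)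
    {L : ℕ} [NeZero L] (hL1 : ∀ l, 2 * (hi l - lo l) < L) (hL2 : ∀ l, hi l + 2 ≤ L) :
    ∀ k, k ≤ d → zdZ ρ β (boxPlaqs lo hi) ^ (2 ^ k) ≤ zdZ ρ β (boxPlaqs (loK lo hi k) hi)
  | 0, _ => by simp [loK_zero]
  | k + 1, hk => by
      have ih := zdZ_boxPlaqs_pow_le hρ hρN hβ lo hi hlohi hpos hL1 hL2 k (by omega)
      have hkd : k < d := by omega
      obtain ⟨i, hik⟩ : ∃ i : Fin d, (i : ℕ) = k := ⟨⟨k, hkd⟩, rfl⟩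
      obtain ⟨H, hHdef⟩ := Int.eq_ofNat_of_zero_le (sub_nonneg.2 (hlohi i))
      have hc : loK lo hi k i = lo i := loK_apply_of_eq lo hi hik
      have hbox : zDouble i (lo i) (boxPlaqs (loK lo hi k) hi) = boxPlaqs (loK lo hi (k + 1)) hi := by
        have h := zDouble_boxPlaqs (loK lo hi k) hi i (by rw [hc]; exact hlohi i)
        rw [hc] at h
        rw [h, ← loK_succ lo hi hik]
      have hmem : ∀ k', ∀ p ∈ boxPlaqs (loK lo hi k') hi, ∀ l, 0 ≤ p.1 l ∧ p.1 l + 2 ≤ L := by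
        intro k' p hp l
        have h1 := (mem_boxPlaqs.1 hp) l
        have h2 := loK_nonneg lo hi hlohi hpos k' l
        have h3 := bump_nonneg p l
        have h4 := hL2 l
        constructor <;> omega
      have hup : ∀ p ∈ boxPlaqs (loK lo hi k) hi, ZIsUpper i (lo i) H p := by
        intro p hp
        have h1 := (mem_boxPlaqs.1 hp) i
        rw [hc] at h1
        unfold ZIsUpper
        by_cases ht : ZTouches i p
        · right; rw [bump_of_touches ht] at h1; exact ⟨ht, h1.1, by omega⟩
        · left; rw [bump_of_not_touches ht] at h1; exact ⟨ht, h1.1, by omega⟩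
      have hHL : 2 * H < L := by have := hL1 i; omega
      have step : zdZ ρ β (boxPlaqs (loK lo hi k) hi) ^ 2 ≤ zdZ ρ β (boxPlaqs (loK lo hi (k + 1)) hi) := by
        rw [← hbox]
        exact zdZ_sq_le_zdZ_zDouble ρ β hρ hρN hβ i (lo i) hHL hup (hmem k) (by rw [hbox]; exact hmem (k + 1))
      calc zdZ ρ β (boxPlaqs lo hi) ^ 2 ^ (k + 1) = (zdZ ρ β (boxPlaqs lo hi) ^ 2 ^ k) ^ 2 := by
            rw [pow_succ, pow_mul]
        _ ≤ zdZ ρ β (boxPlaqs (loK lo hi k) hi) ^ 2 :=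
            pow_le_pow_left₀ (pow_nonneg (zdZ_nonneg ρ β _) _) ih 2
        _ ≤ _ := step

/-- **Free-cube doubling.** `Z([0,m)^d)^(2^d) ≤ Z([0,2m-1)^d)` for the free-boundary Wilson partition functions of
any compact gauge group, any `β ≥ 0`, any `m ≥ 1` (Glimm–Jaffe multiple reflections for product Haar measure). -/
theorem zdZ_cubePlaqs_pow_le (hρ : Continuous ρ) (hρN : ∀ g, (ρ g).trace.re ≤ N) (hβ : 0 ≤ β) {m : ℕ}
    (hm : 1 ≤ m) :
    zdZ ρ β (ChatterjeeFreeEnergy.cubePlaqs d m) ^ (2 ^ d) ≤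
      zdZ ρ β (ChatterjeeFreeEnergy.cubePlaqs d (2 * m - 1)) := by
  set lo : Fin d → ℤ := fun _ => (m : ℤ) - 1 with hlo
  set hi : Fin d → ℤ := fun _ => 2 * (m : ℤ) - 2 with hhi
  have hshift : (boxPlaqs (fun _ => (0 : ℤ)) (fun _ => (m : ℤ) - 1)).image
      (fun p : ZdPlaquette d => (p.1 + lo, p.2)) = boxPlaqs lo hi := by
    rw [boxPlaqs_image_shift]
    congr 1 <;> funext l <;> simp [hlo, hhi]; ring
  have h1 : zdZ ρ β (ChatterjeeFreeEnergy.cubePlaqs d m) = zdZ ρ β (boxPlaqs lo hi) := by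
    rw [cubePlaqs_eq_boxPlaqs, ← hshift]
    exact (FreeEnergy.zdZ_image_shift ρ hρ β lo _).symm
  have h2 : boxPlaqs (loK lo hi d) hi = ChatterjeeFreeEnergy.cubePlaqs d (2 * m - 1) := by
    rw [loK_of_le lo hi le_rfl, cubePlaqs_eq_boxPlaqs]
    have hcast : ((2 * m - 1 : ℕ) : ℤ) = 2 * (m : ℤ) - 1 := by omega
    congr 1 <;> funext l <;> simp only [hlo, hhi, hcast] <;> ring
  haveI : NeZero (2 * m + 1) := ⟨by omega⟩
  have h3 := zdZ_boxPlaqs_pow_le ρ β hρ hρN hβ lo hi (fun l => by simp only [hlo, hhi]; omega)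
    (fun l => by simp only [hlo, hhi]; omega) (L := 2 * m + 1)
    (fun l => by simp only [hlo, hhi]; push_cast; omega) (fun l => by simp only [hhi]; push_cast; omega) d le_rfl
  rw [h1, ← h2]
  exact h3

/-- The same in terms of the tree's `zdPartitionFunction` on half-open site boxes, `d = 4`:
`Z(B_m)^16 ≤ Z(B_{2m-1})` — the hypothesis `FreeCubeRPDoubling` of `Lines/pressure_monotone_tm.lean` §5. -/
theorem zdPartitionFunction_halfOpenBox_pow_sixteen_le (hρ : Continuous ρ) (hρN : ∀ g, (ρ g).trace.re ≤ N)
    (hβ : 0 ≤ β) {m : ℕ} (hm : 1 ≤ m) :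
    (zdPartitionFunction ρ β (halfOpenBox 4 m)).toReal ^ 16 ≤
      (zdPartitionFunction ρ β (halfOpenBox 4 (2 * m - 1))).toReal := by
  rw [ChatterjeeFreeEnergy.zdPartitionFunction_toReal_eq ρ hρ β m,
    ChatterjeeFreeEnergy.zdPartitionFunction_toReal_eq ρ hρ β (2 * m - 1)]
  have h := zdZ_cubePlaqs_pow_le (d := 4) ρ β hρ hρN hβ hm
  norm_num at h
  exact h

end Boxes

end

end Summit.QuantumFields.YangMills.Cruxes.IR.RPDoubling
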